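import Mathlib.LinearAlgebra.Matrix.NonsingularInverse
import Mathlib.LinearAlgebra.Matrix.Adjugate
import Mathlib.Data.Matrix.ColumnRowPartitioned
import Mathlib.Analysis.Calculus.FDeriv.Mul
import Mathlib.Analysis.Calculus.FDeriv.Add
import Mathlib.Analysis.Complex.Basic
import Mathlib.Topology.Algebra.GroupWithZero
import Mathlib.Topology.Instances.Matrix
import HarnessLib

/-!
# Cramer's rule is holomorphic / continuous: determinant, adjugate, inverse and products of matrix-valued maps,
# and the normalised period matrix `t ↦ Δ · Π_μ(t)⁻¹ · Π_λ(t)`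

Topic `Analysis/Matrix`; namespace `Literature.Analysis.Matrix`.  KERNEL ONLY: theorems; no definition, no named fact, no
instance, no `sorry`.  Generic (Mathlib-gap) calculus leaf, written for cell `hodgecm-mathlib` (D-0151) U-e socket P4 road
step (e) = census `CENSUS-Ue-P4` (B-p05 (g13)) item (L7), generic half: «if the periods `Π(t)` are holomorphic in `t` and the
block `Π_μ(t)` is invertible, then the Siegel point `t ↦ Δ Π_μ(t)⁻¹ Π_λ(t)` is holomorphic» ([LangeBirkenhake1992] Ch. 8
§8.1–8.2, the period map of a family), plus the continuous version for the `ContinuousOn π W` clause.  The pointwise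
companion (which block, why invertible, why in `𝔥_g`) is `ModuliOfAbelianVarieties/SiegelPointOfFramedTorus.lean`.
HC_CM is proved only modulo the 7 printed citations until rung 0 closes; nothing here changes that count (books 0).

(Sibling statements for other purposes exist in unrelated corners of the tree — e.g.
`MathematicalPhysics/QuantumFieldTheory/Balaban1983to89/B13CovarianceDifference216` §3,
`AlgebraicGeometry/RealAlgebraic/SubmanifoldTangent` (real `C^∞`) — and are not imported here to keep this leaf's cone at
Mathlib.)

* `differentiableOn_matrix_det / _adjugate / _inv / _mul` (domain any complex normed space, on a set),
* `continuousOn_matrix_det / _adjugate / _inv / _mul` (domain any topological space, on a set),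
* `differentiableOn_siegelPoint_of_periodMatrix`, `continuousOn_siegelPoint_of_periodMatrix(')`.

## References
* [MagnusNeudecker2019] J. R. Magnus, H. Neudecker, *Matrix Differential Calculus*, 3rd ed. (2019), Ch. 8 (differential of
  determinant and inverse).
* [LangeBirkenhake1992] H. Lange, Ch. Birkenhake, *Complex Abelian Varieties* (1992), Ch. 8 §8.1–8.2.
-/

set_option autoImplicit false

noncomputable section

open Matrix

namespace Literature.Analysis.Matrix

/-! ### §5 (L7, generic half) Cramer's rule is holomorphic: `t ↦ Δ · Π_μ(t)⁻¹ · Π_λ(t)` from holomorphic periods -/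

section Cramer

variable {X : Type*} [NormedAddCommGroup X] [NormedSpace ℂ X] {m : Type*} [Fintype m] [DecidableEq m] {s : Set X}

/-- The determinant of a matrix of holomorphic functions is holomorphic. [folklore] [cite: MagnusNeudecker2019, Ch. 8] -/
theorem differentiableOn_matrix_det {M : X → Matrix m m ℂ}
    (hM : ∀ i j, DifferentiableOn ℂ (fun y => M y i j) s) :
    DifferentiableOn ℂ (fun y => (M y).det) s := by
  have h : (fun y => (M y).det) =
      fun y => ∑ σ : Equiv.Perm m, ((Equiv.Perm.sign σ : ℤ) : ℂ) * ∏ i, M y (σ i) i := by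
    funext y
    rw [Matrix.det_apply']
  rw [h]
  refine DifferentiableOn.fun_sum fun σ _ => (differentiableOn_const _).fun_mul ?_
  -- the product of the differentiable entries `y ↦ M y (σ i) i` (general normed domain)
  intro x hx
  exact (HasFDerivWithinAt.finsetProd (u := Finset.univ) (g := fun i y => M y (σ i) i)
    fun i _ => (hM (σ i) i x hx).hasFDerivWithinAt).differentiableWithinAt

/-- The adjugate of a matrix of holomorphic functions has holomorphic entries. [folklore] [cite: MagnusNeudecker2019, Ch. 8] -/
theorem differentiableOn_matrix_adjugate {M : X → Matrix m m ℂ}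
    (hM : ∀ i j, DifferentiableOn ℂ (fun y => M y i j) s) (i j : m) :
    DifferentiableOn ℂ (fun y => (M y).adjugate i j) s := by
  simp only [Matrix.adjugate_apply]
  refine differentiableOn_matrix_det fun i' j' => ?_
  simp only [Matrix.updateRow_apply]
  by_cases h : i' = j
  · simp only [h, if_true]
    exact differentiableOn_const _
  · simp only [h, if_false]
    exact hM i' j'

/-- **Cramer's rule is holomorphic**: where the determinant does not vanish, the inverse of a matrix of holomorphic
functions has holomorphic entries. [folklore] [cite: MagnusNeudecker2019, Ch. 8] -/
theorem differentiableOn_matrix_inv {M : X → Matrix m m ℂ}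
    (hM : ∀ i j, DifferentiableOn ℂ (fun y => M y i j) s) (hdet : ∀ y ∈ s, (M y).det ≠ 0) (i j : m) :
    DifferentiableOn ℂ (fun y => (M y)⁻¹ i j) s := by
  have h : (fun y => (M y)⁻¹ i j) = fun y => ((M y).det)⁻¹ * (M y).adjugate i j := by
    funext y
    rw [Matrix.inv_def, Ring.inverse_eq_inv, Matrix.smul_apply, smul_eq_mul]
  rw [h]
  exact ((differentiableOn_matrix_det hM).fun_inv hdet).fun_mul (differentiableOn_matrix_adjugate hM i j)

omit [DecidableEq m] in
/-- Entries of a product of matrices of holomorphic functions are holomorphic. [folklore] [cite: MagnusNeudecker2019, Ch. 8] -/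
theorem differentiableOn_matrix_mul {l p : Type*} [Fintype l] [Fintype p] {M : X → Matrix l m ℂ}
    {N : X → Matrix m p ℂ} (hM : ∀ i j, DifferentiableOn ℂ (fun y => M y i j) s)
    (hN : ∀ i j, DifferentiableOn ℂ (fun y => N y i j) s) (i : l) (j : p) :
    DifferentiableOn ℂ (fun y => (M y * N y) i j) s := by
  simp only [Matrix.mul_apply]
  exact DifferentiableOn.fun_sum fun k _ => (hM i k).fun_mul (hN k j)

/-- **THE NORMALISED PERIOD MATRIX IS HOLOMORPHIC (U-e P4 road step (e), generic half = census (L7)).**  If the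
period matrix `Π(t) ∈ M_{g × 2g}(ℂ)` of a family of framed tori depends holomorphically on `t ∈ s` (entrywise
`DifferentiableOn ℂ` on a set `s` of a complex normed space — e.g. the holomorphic coordinates of a Hodge frame of `F¹H¹`
against a flat symplectic frame, in an algebraic chart) and the `μ`-block `Π_μ(t)` is invertible on `s`, then every entry
of the Siegel point `t ↦ Δ · Π_μ(t)⁻¹ · Π_λ(t)` is holomorphic on `s` ([LangeBirkenhake1992] §8.1–8.2 «the period map of a
family»: it is a rational function of the periods).  [cite: LangeBirkenhake1992, Ch. 8 §8.1–8.2]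
[cite: VoisinHodgeI2002, §10.2.1 Thm. 10.3 and §9.1.2] -/
theorem differentiableOn_siegelPoint_of_periodMatrix {g : ℕ} (δ : Fin g → ℕ)
    {P : X → Matrix (Fin g) (Fin g ⊕ Fin g) ℂ} (hP : ∀ i k, DifferentiableOn ℂ (fun y => P y i k) s)
    (hdet : ∀ y ∈ s, (P y).toCols₂.det ≠ 0) (i j : Fin g) :
    DifferentiableOn ℂ
      (fun y => (Matrix.diagonal (fun i ↦ (δ i : ℂ)) * ((P y).toCols₂)⁻¹ * (P y).toCols₁) i j) s := by
  have hinv : ∀ a b, DifferentiableOn ℂ (fun y => ((P y).toCols₂)⁻¹ a b) s := fun a b =>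
    differentiableOn_matrix_inv (M := fun y => (P y).toCols₂) (fun a' b' => hP a' (Sum.inr b')) hdet a b
  have hΔ : ∀ a b, DifferentiableOn ℂ (fun _ : X => (Matrix.diagonal (fun i ↦ (δ i : ℂ))) a b) s := fun a b =>
    differentiableOn_const _
  have h1 : ∀ a b, DifferentiableOn ℂ
      (fun y => (Matrix.diagonal (fun i ↦ (δ i : ℂ)) * ((P y).toCols₂)⁻¹) a b) s := fun a b =>
    differentiableOn_matrix_mul (M := fun _ : X => Matrix.diagonal (fun i ↦ (δ i : ℂ)))
      (N := fun y => ((P y).toCols₂)⁻¹) hΔ hinv a b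
  exact differentiableOn_matrix_mul (M := fun y => Matrix.diagonal (fun i ↦ (δ i : ℂ)) * ((P y).toCols₂)⁻¹)
    (N := fun y => (P y).toCols₁) h1 (fun a b => hP a (Sum.inl b)) i j

end Cramer

/-! ### §6 The same, continuous version (the `ContinuousOn π W` clause of P4) -/

section CramerContinuous

variable {X : Type*} [TopologicalSpace X] {m : Type*} [Fintype m] [DecidableEq m] {s : Set X}

/-- The determinant of a matrix of continuous functions is continuous (on a set). [folklore] [cite: MagnusNeudecker2019, Ch. 8] -/
theorem continuousOn_matrix_det {M : X → Matrix m m ℂ}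
    (hM : ∀ i j, ContinuousOn (fun y => M y i j) s) :
    ContinuousOn (fun y => (M y).det) s := by
  have h : (fun y => (M y).det) =
      fun y => ∑ σ : Equiv.Perm m, ((Equiv.Perm.sign σ : ℤ) : ℂ) * ∏ i, M y (σ i) i := by
    funext y
    rw [Matrix.det_apply']
  rw [h]
  exact continuousOn_finsetSum _ fun σ _ =>
    continuousOn_const.fun_mul (continuousOn_finsetProd _ fun i _ => hM (σ i) i)

/-- The adjugate of a matrix of continuous functions has continuous entries (on a set). [folklore] [cite: MagnusNeudecker2019, Ch. 8] -/
theorem continuousOn_matrix_adjugate {M : X → Matrix m m ℂ}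
    (hM : ∀ i j, ContinuousOn (fun y => M y i j) s) (i j : m) :
    ContinuousOn (fun y => (M y).adjugate i j) s := by
  simp only [Matrix.adjugate_apply]
  refine continuousOn_matrix_det fun i' j' => ?_
  simp only [Matrix.updateRow_apply]
  by_cases h : i' = j
  · simp only [h, if_true]
    exact continuousOn_const
  · simp only [h, if_false]
    exact hM i' j'

/-- Cramer's rule is continuous: where the determinant does not vanish, the inverse of a matrix of continuous
functions has continuous entries (on a set). [folklore] [cite: MagnusNeudecker2019, Ch. 8] -/
theorem continuousOn_matrix_inv {M : X → Matrix m m ℂ}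
    (hM : ∀ i j, ContinuousOn (fun y => M y i j) s) (hdet : ∀ y ∈ s, (M y).det ≠ 0) (i j : m) :
    ContinuousOn (fun y => (M y)⁻¹ i j) s := by
  have h : (fun y => (M y)⁻¹ i j) = fun y => ((M y).det)⁻¹ * (M y).adjugate i j := by
    funext y
    rw [Matrix.inv_def, Ring.inverse_eq_inv, Matrix.smul_apply, smul_eq_mul]
  rw [h]
  exact ((continuousOn_matrix_det hM).fun_inv₀ hdet).fun_mul (continuousOn_matrix_adjugate hM i j)

omit [DecidableEq m] in
/-- Entries of a product of matrices of continuous functions are continuous (on a set). [folklore] [cite: MagnusNeudecker2019, Ch. 8] -/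
theorem continuousOn_matrix_mul {l p : Type*} [Fintype l] [Fintype p] {M : X → Matrix l m ℂ}
    {N : X → Matrix m p ℂ} (hM : ∀ i j, ContinuousOn (fun y => M y i j) s)
    (hN : ∀ i j, ContinuousOn (fun y => N y i j) s) (i : l) (j : p) :
    ContinuousOn (fun y => (M y * N y) i j) s := by
  simp only [Matrix.mul_apply]
  exact continuousOn_finsetSum _ fun k _ => (hM i k).fun_mul (hN k j)

/-- **THE NORMALISED PERIOD MATRIX IS CONTINUOUS** (the `ContinuousOn π W` clause of U-e P4): if the period matrix
`Π(t)` depends continuously on `t ∈ s` (entrywise) and `Π_μ(t)` is invertible on `s`, then every entry of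
`t ↦ Δ · Π_μ(t)⁻¹ · Π_λ(t)` is continuous on `s`. [cite: LangeBirkenhake1992, Ch. 8 §8.1–8.2] -/
theorem continuousOn_siegelPoint_of_periodMatrix {g : ℕ} (δ : Fin g → ℕ)
    {P : X → Matrix (Fin g) (Fin g ⊕ Fin g) ℂ} (hP : ∀ i k, ContinuousOn (fun y => P y i k) s)
    (hdet : ∀ y ∈ s, (P y).toCols₂.det ≠ 0) (i j : Fin g) :
    ContinuousOn (fun y => (Matrix.diagonal (fun i ↦ (δ i : ℂ)) * ((P y).toCols₂)⁻¹ * (P y).toCols₁) i j) s := by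
  have hinv : ∀ a b, ContinuousOn (fun y => ((P y).toCols₂)⁻¹ a b) s := fun a b =>
    continuousOn_matrix_inv (M := fun y => (P y).toCols₂) (fun a' b' => hP a' (Sum.inr b')) hdet a b
  have hΔ : ∀ a b, ContinuousOn (fun _ : X => (Matrix.diagonal (fun i ↦ (δ i : ℂ))) a b) s := fun a b =>
    continuousOn_const
  have h1 : ∀ a b, ContinuousOn
      (fun y => (Matrix.diagonal (fun i ↦ (δ i : ℂ)) * ((P y).toCols₂)⁻¹) a b) s := fun a b =>
    continuousOn_matrix_mul (M := fun _ : X => Matrix.diagonal (fun i ↦ (δ i : ℂ)))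
      (N := fun y => ((P y).toCols₂)⁻¹) hΔ hinv a b
  exact continuousOn_matrix_mul (M := fun y => Matrix.diagonal (fun i ↦ (δ i : ℂ)) * ((P y).toCols₂)⁻¹)
    (N := fun y => (P y).toCols₁) h1 (fun a b => hP a (Sum.inl b)) i j

/-- The whole matrix `t ↦ Δ · Π_μ(t)⁻¹ · Π_λ(t)` is continuous on `s` (matrix-valued form of the previous lemma, the shape
of the socket's `ContinuousOn π W`). [cite: LangeBirkenhake1992, Ch. 8 §8.1–8.2] -/
theorem continuousOn_siegelPoint_of_periodMatrix' {g : ℕ} (δ : Fin g → ℕ)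
    {P : X → Matrix (Fin g) (Fin g ⊕ Fin g) ℂ} (hP : ∀ i k, ContinuousOn (fun y => P y i k) s)
    (hdet : ∀ y ∈ s, (P y).toCols₂.det ≠ 0) :
    ContinuousOn (fun y => Matrix.diagonal (fun i ↦ (δ i : ℂ)) * ((P y).toCols₂)⁻¹ * (P y).toCols₁) s :=
  continuousOn_pi.2 fun i => continuousOn_pi.2 fun j => continuousOn_siegelPoint_of_periodMatrix δ hP hdet i j

end CramerContinuous

end Literature.Analysis.Matrix

end
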